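import Mathlib
import HarnessLib
import Literature.ComputerArithmetic.BrisebarreHanrotMullerZimmermann2025.ExpSiblings

/-!
# Hyperbolic cotangent decay bounds

Helper lemmas for `CombDescentStep` (stmt-RiemannHypothesis-3184) `combFieldEstimate`.

The main result is `abs_coth_sub_one_le`: for `α ≥ 1`, `|coth α - 1| ≤ 3 exp(-2α)`.
This bounds how fast `coth` approaches 1 for large arguments, which is needed to show that
the exact comb sum's deviation from `-iπ/s` is negligible when `h ≥ 2s`.

## Main results

* `exp_neg_two_le`: `exp(-2) ≤ 0.14`
* `one_sub_exp_neg_two_mul_pos`: for `α ≥ 1`, `1 - exp(-2α) ≥ 0.86`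
* `coth_sub_one_eq`: `coth α - 1 = 2 exp(-2α) / (1 - exp(-2α))` for `α > 0`
* `abs_coth_sub_one_le`: for `α ≥ 1`, `|coth α - 1| ≤ 3 exp(-2α)`
-/

open Real Complex Set Filter Topology
open scoped BigOperators Topology

noncomputable section

namespace EarlyAppointmentsCothBound

/-- `exp(-2) ≤ 0.14`. Simple numeric bound.
We use exp(-2) = 1/exp(2) < 1/7.14 < 0.14 since exp(2) > 7.14 (as exp(1) > 2.67 and 2.67^2 > 7.14). -/
theorem exp_neg_two_le : Real.exp (-2 : ℝ) ≤ 0.14 := by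
  rw [Real.exp_neg]
  have he1 : (2.68 : ℝ) < Real.exp 1 := lt_trans (by norm_num) Real.exp_one_gt_d9
  have h714 : (7.1824 : ℝ) < Real.exp 2 := by
    have h268sq : (7.1824 : ℝ) = 2.68 ^ 2 := by norm_num
    calc (7.1824 : ℝ) = 2.68 ^ 2 := h268sq
      _ < (Real.exp 1) ^ 2 := by nlinarith
      _ = Real.exp 2 := by rw [← Real.exp_nat_mul]; norm_num
  have hexp2_pos : 0 < Real.exp 2 := Real.exp_pos 2
  have h714pos : (0 : ℝ) < 7.1824 := by norm_num
  have hinv : (Real.exp 2)⁻¹ < (7.1824 : ℝ)⁻¹ := (inv_lt_inv₀ hexp2_pos h714pos).mpr h714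
  have hinv_bound : (7.1824 : ℝ)⁻¹ < 0.14 := by
    have : (7.1824 : ℝ)⁻¹ = 1 / 7.1824 := inv_eq_one_div 7.1824
    rw [this]; norm_num
  have hfinal : (Real.exp 2)⁻¹ < 0.14 := lt_trans hinv hinv_bound
  linarith

/-- For `α ≥ 1`, we have `1 - exp(-2α) ≥ 1 - exp(-2) > 0.86`.
This is the denominator bound needed for coth estimates. -/
theorem one_sub_exp_neg_two_mul_pos {α : ℝ} (hα : 1 ≤ α) : 0.86 ≤ 1 - Real.exp (-2 * α) := by
  have h1 : -2 * α ≤ -2 := by linarith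
  have h2 : Real.exp (-2 * α) ≤ Real.exp (-2) := Real.exp_le_exp_of_le h1
  have h3 := exp_neg_two_le
  linarith

/-- For `α > 0`, `coth α - 1 = 2 exp(-2α) / (1 - exp(-2α))`. -/
theorem coth_sub_one_eq {α : ℝ} (hα : 0 < α) :
    Real.cosh α / Real.sinh α - 1 = 2 * Real.exp (-2 * α) / (1 - Real.exp (-2 * α)) := by
  have hne : Real.sinh α ≠ 0 := (Real.sinh_pos_iff.mpr hα).ne'
  have h1 : Real.exp (-2 * α) < 1 := Real.exp_lt_one_iff.mpr (by linarith)
  have h1ne : 1 - Real.exp (-2 * α) ≠ 0 := (by linarith : 0 < 1 - Real.exp (-2 * α)).ne'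
  rw [Literature.ComputerArithmetic.BrisebarreHanrotMullerZimmermann2025.coth_eq_exp_neg_two_mul hα.ne']
  rw [div_sub_one h1ne]
  congr 1
  ring

/-- **Hyperbolic cotangent decay**: for `α ≥ 1`, `|coth α - 1| ≤ 3 exp(-2α)`.
The key bound for showing the exact comb sum's deviation from `-iπ/s` is negligible. -/
theorem abs_coth_sub_one_le {α : ℝ} (hα : 1 ≤ α) :
    |Real.cosh α / Real.sinh α - 1| ≤ 3 * Real.exp (-2 * α) := by
  have hpos : 0 < α := lt_of_lt_of_le zero_lt_one hα
  rw [coth_sub_one_eq hpos]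
  have h_exp_pos : 0 < Real.exp (-2 * α) := Real.exp_pos _
  have h_denom_pos : 0 < 1 - Real.exp (-2 * α) := by
    have := one_sub_exp_neg_two_mul_pos hα
    linarith
  have h_denom_bound := one_sub_exp_neg_two_mul_pos hα
  rw [abs_of_pos (by positivity : 0 < 2 * Real.exp (-2 * α) / (1 - Real.exp (-2 * α)))]
  rw [div_le_iff₀ h_denom_pos]
  calc 2 * Real.exp (-2 * α) ≤ 3 * Real.exp (-2 * α) * 0.86 := by
        have hexp : 0 < Real.exp (-2 * α) := Real.exp_pos _
        nlinarith
    _ ≤ 3 * Real.exp (-2 * α) * (1 - Real.exp (-2 * α)) := by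
        have := one_sub_exp_neg_two_mul_pos hα
        have hexp : 0 < Real.exp (-2 * α) := Real.exp_pos _
        nlinarith

end EarlyAppointmentsCothBound

end
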